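import Literature.NumberTheory.EllipticCurves.LocalTatePairingPoints
import Literature.NumberTheory.GaloisCohomology.LocalInvariantMapPadic
import HarnessLib

/-!
# The `ℤ_p`-valued local Tate pairing on `H¹(F, T_pW)` IS `inv_∞ ∘ (cup product of the `ℤ_p(1)`-valued Weil pairing)`

Topic `NumberTheory/EllipticCurves`; namespace `Literature.NumberTheory.EllipticCurves`. Sequel of
`LocalTatePairingTateModule.lean` (the tree's `ℤ_p`-valued local Tate pairing `tatePairing`, DEFINED as the `p`-adic
integer whose residues are the level-`p^k` self-pairings `⟨pr_k x, pr_k y⟩_{p^k, inv_{p^k}}`) and of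
`GaloisCohomology/LocalInvariantMapPadic.lean` (`ℤ_p(1) = lim_k μ_{p^k}(F̄)` as the jointly continuous representation
`tateModuleMuPadic F p`, and THE `p`-adic invariant map `invPadic F p : H²_cont(Γ_F, ℤ_p(1)) ⥲ ℤ_p` with its level formula).
Definitions with bodies and theorems; no named fact, no instance, no `sorry`.

This file packages the `ℤ_p`-COEFFICIENT form of the pairing, i.e. the shape in which Kato states and proves the
reciprocity law (LNM 1553, Ch. II §1.4: `H¹(K, T) × H¹(K, T*(1)) →(∪) H²(K, ℤ_p(1)) ≅ ℤ_p`), and proves that it agrees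
with the tree's level-wise definition:

* `weilPairingPadicCoord`, `weilPairingPadicHom` and ★ **`weilContPairingPadic W F p e … : T_pW|_{Γ_F} × T_pW|_{Γ_F} → ℤ_p(1)(F̄)`**,
  the `ℤ_p(1)`-valued Weil pairing `e_∞(a, b) = (ι_k e_k(a_k, b_k))_k` of a level-compatible tower of Weil pairings
  `e_k` (Silverman III.8.1 (e): `e_k(pS, pT) = e_{k+1}(S, T)^p`; `ι_k : μ_{p^k}(K̄₀) ⥲ μ_{p^k}(F̄)` the tree's `muTransfer`),
  as a continuous `Γ_F`-equivariant biadditive pairing (`ContPairing`) of the topological representations of the tree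
  (`PAdicHodge.restrictedTateRep`, `GaloisCohomology.tateModuleMuPadic`) — coherence of the coordinates
  (`red_weilPairingPadicCoord_succ`), biadditivity, equivariance (`weilPairingPadicHom_smul`), continuity;
* `weilContPairingTransfer … k` — the level-`p^k` Weil pairing with values transferred to `μ_{p^k}(F̄)`, and the two
  cup-product compatibilities ★ `cohomologyMap_projHom_cupProduct_weilContPairingPadic`
  (`H²(ℤ_p(1) ↠ μ_{p^k})(x ∪_∞ y) = pr_k x ∪_k pr_k y`, naturality `ContPairing.cupProduct_map`) and
  `cohomologyMap_muRestrictIso_cupProduct_restrict` (comparison with the restricted Weil cup product of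
  `LocalWeilPairingDuality.lean`);
* ★★ **`tatePairing_eq_invPadic_cupProduct`: `⟨x, y⟩ = inv_∞(x ∪_{e_∞} y)`** for all `x, y ∈ H¹(F, T_pW|_{Γ_F})` — the
  tree's `tatePairing` is the composite `H¹ × H¹ →(∪_{e_∞}) H²_cont(Γ_F, ℤ_p(1)) →(inv_∞) ℤ_p` (by the level formulae
  `toZModPow_tatePairing`, `toZModPow_invPadic` and `levelTatePairing_eq_iota_weilCupProduct`, a `p`-adic integer being
  determined by its residues); on cocycles `tatePairing_oneCocycleClass_eq_invPadic_twoCocycleClass`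
  (`⟨[η], [η']⟩ = inv_∞[(σ, τ) ↦ e_∞(η σ, σ η' τ)]`); `tatePairingPoint_eq_invPadic_cupProduct` — the same for the pairing
  with the Kummer image `⟨x, P⟩` (`LocalTatePairingPoints.lean`) given any `T`-adic Kummer class `y` of `P`.

With this bridge the `H²(Γ_F, ℤ_p(1))`-valued cochain calculus of `GaloisRepresentations/ContinuousCohomologyCoboundaryLift`,
`ContinuousCupProductCoboundaryLift` (Kato's "formal argument", II Lemma 1.4.3) and `CyclicClassLocalArtinSymbol*` /
`LocalInvariantMapPadic` (II 1.4.2, Lemma 1.4.5) computes THE pairing of the reciprocity law [REC]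
(`EllipticCurves.tatePairingPoint_eq_trace_expStar_log`). Brick of the K3 programme of the line `kato_lever` on crux K★
stmt-BirchSwinnertonDyer-22226; BSD / K★ / [REC] are NOT proved by any of this.

## References
* K. Kato, *Lectures on the approach to Iwasawa theory for Hasse–Weil L-functions via B_dR, I*, LNM 1553 (1993),
  Ch. II §1.4, Thm. 1.4.1 (1), (3). [Kato1993LNM1553]
* J. Neukirch, A. Schmidt, K. Wingberg, *Cohomology of Number Fields*, 2nd ed. (2008), I §4 (1.4.2), II §7 (2.7.5),
  VII (7.2.6). [NeukirchSchmidtWingberg2008]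
* J. H. Silverman, *The Arithmetic of Elliptic Curves*, 2nd ed. (2009), III §7, Prop. III.8.1 (e). [SilvermanAEC2009]
-/

noncomputable section

open CategoryTheory Function Field
open Literature.NumberTheory.GaloisRepresentations
open Literature.NumberTheory.GaloisRepresentations.DiscreteGaloisModule (mu MuCarrier pairing pairing_toLin_apply)
open Literature.NumberTheory.GaloisCohomology (muPadicSystem muPadicChain tateModuleMuPadic invPadic toZModPow_invPadic
  muPadicSystem_red)
open Literature.NumberTheory.PAdicHodge (restrictedTateRep restrictedTateRep_apply_apply)
open Literature.AnabelianGeometry.AbsoluteAnabelian (Prop121vii.invLevel muPow muVal_muPow)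

namespace Literature.NumberTheory.EllipticCurves

open _root_.WeierstrassCurve

attribute [local instance] absoluteGaloisGroup_compactSpace
attribute [local instance] finite_geomTorsion_of_neZero

-- universe-monomorphic, as `PAdicHodge.restrictedTateRep`
variable {K₀ : Type} [Field K₀] (W : WeierstrassCurve K₀) (F : Type) [Field F] [Algebra K₀ F]
  (p : ℕ) [hp : Fact p.Prime]

/-- `p^k ≠ 0`: instance bookkeeping for the levels. [folklore] -/
private theorem neZero_pow₄ (k : ℕ) : NeZero (p ^ k) := ⟨pow_ne_zero k hp.out.ne_zero⟩

attribute [local instance] neZero_pow₄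

variable (e : (k : ℕ) → geomTorsion W ((p ^ k : ℕ) : ℤ) → geomTorsion W ((p ^ k : ℕ) : ℤ) → AlgebraicClosure K₀)
  (hμ : ∀ k S T, e k S T ^ (p ^ k) = 1)
  (hadd₁ : ∀ k S₁ S₂ T, e k (S₁ + S₂) T = e k S₁ T * e k S₂ T)
  (hadd₂ : ∀ k S T₁ T₂, e k S (T₁ + T₂) = e k S T₁ * e k S T₂)
  (hgal : ∀ k (σ : absoluteGaloisGroup K₀) (S T : geomTorsion W ((p ^ k : ℕ) : ℤ)),
    σ • e k S T = e k (σ • S) (σ • T))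
  (hcompat : ∀ k (S T : geomTorsion W ((p ^ (k + 1) : ℕ) : ℤ)),
    e k (torsionMulHom W (p ^ (k + 1)) (p ^ k) p (pow_succ p k).symm S)
      (torsionMulHom W (p ^ (k + 1)) (p ^ k) p (pow_succ p k).symm T) = e (k + 1) S T ^ p)

/-! ### Bookkeeping on the projections `pr_k : T_pW → E[p^k]` and the level Weil pairings -/

omit hp in
/-- `p · pr_{k+1} = pr_k` on the geometric torsion (`TateModule.smul_proj_succ`). [cite: SilvermanAEC2009, III §7] -/
theorem torsionMulHom_tateProjHom_succ (k : ℕ) (a : W.tateModule p) :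
    torsionMulHom W (p ^ (k + 1)) (p ^ k) p (pow_succ p k).symm (tateProjHom W p (k + 1) a) = tateProjHom W p k a :=
  Subtype.ext (by
    rw [coe_torsionMulHom, coe_tateProjHom, coe_tateProjHom, natCast_zsmul, TateModule.smul_proj_succ])

omit hp in
/-- `pr_k` commutes with the Galois action: `pr_k(g a) = g · pr_k(a)` in `E[p^k]`. [cite: SilvermanAEC2009, III §7] -/
theorem tateProjHom_smul (k : ℕ) (g : absoluteGaloisGroup K₀) (a : W.tateModule p) :
    tateProjHom W p k (g • a) = W.torsionGaloisModule ((p ^ k : ℕ) : ℤ) g (tateProjHom W p k a) :=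
  Subtype.ext (by
    rw [torsionGaloisModule_apply_apply, AddSubgroup.torsionBy.coe_smul, coe_tateProjHom, coe_tateProjHom,
      TateModule.proj_smul_of_distribMulAction])

omit hp in
include hcompat in
/-- The tower compatibility on the Tate module: `e_k(pr_k a, pr_k b) = e_{k+1}(pr_{k+1} a, pr_{k+1} b)^p`.
[cite: SilvermanAEC2009, Prop. III.8.1 (e)] -/
theorem weil_tateProjHom_succ (k : ℕ) (a b : W.tateModule p) :
    e k (tateProjHom W p k a) (tateProjHom W p k b) =
      e (k + 1) (tateProjHom W p (k + 1) a) (tateProjHom W p (k + 1) b) ^ p := by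
  rw [← torsionMulHom_tateProjHom_succ W p k a, ← torsionMulHom_tateProjHom_succ W p k b]
  exact hcompat k _ _

include hgal in
/-- Equivariance of the additive level pairing `weilPairingHom` under `Γ_{K₀}` (from `weilContPairing.toLin_smul`).
[cite: SilvermanAEC2009, Prop. III.8.1 (d)] -/
theorem weilPairingHom_smul (k : ℕ) (g : absoluteGaloisGroup K₀) (S T : geomTorsion W ((p ^ k : ℕ) : ℤ)) :
    weilPairingHom W (p ^ k) (e k) (hμ k) (hadd₁ k) (hadd₂ k) (g • S) (g • T) =
      mu K₀ (p ^ k) g (weilPairingHom W (p ^ k) (e k) (hμ k) (hadd₁ k) (hadd₂ k) S T) :=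
  (weilContPairing W (p ^ k) (e k) (hμ k) (hadd₁ k) (hadd₂ k) (hgal k)).toLin_smul g S T

/-- The underlying element of `K̄₀` of the additive level pairing is `e_k(S, T)`. [cite: SilvermanAEC2009, Prop. III.8.1] -/
theorem coe_muVal_weilPairingHom (k : ℕ) (S T : geomTorsion W ((p ^ k : ℕ) : ℤ)) :
    ((muVal K₀ (p ^ k) (weilPairingHom W (p ^ k) (e k) (hμ k) (hadd₁ k) (hadd₂ k) S T) :
      (AlgebraicClosure K₀)ˣ) : AlgebraicClosure K₀) = e k S T := rfl

/-! ### The `ℤ_p(1)`-valued Weil pairing `e_∞` on `T_pW|_{Γ_F}` -/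

/-- **The level-`k` coordinate of `e_∞(a, b)`**: `ι_k(e_k(pr_k a, pr_k b)) ∈ μ_{p^k}(F̄)` (`ι_k = muTransfer`, the transfer of
roots of unity along the chosen `K̄₀ → F̄`). [cite: NeukirchSchmidtWingberg2008, VII (7.2.6)] -/
def weilPairingPadicCoord (k : ℕ) (a b : W.tateModule p) : MuCarrier F (p ^ k) :=
  muTransfer K₀ F (p ^ k)
    (weilPairingHom W (p ^ k) (e k) (hμ k) (hadd₁ k) (hadd₂ k) (tateProjHom W p k a) (tateProjHom W p k b))

/-- The underlying unit of the level-`k` coordinate is the image of `e_k(pr_k a, pr_k b)` in `F̄`.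
[cite: NeukirchSchmidtWingberg2008, VII (7.2.6)] -/
theorem coe_muVal_weilPairingPadicCoord (k : ℕ) (a b : W.tateModule p) :
    ((muVal F (p ^ k) (weilPairingPadicCoord W F p e hμ hadd₁ hadd₂ k a b) : (AlgebraicClosure F)ˣ) : AlgebraicClosure F) =
      absClosureEmbedding K₀ F (e k (tateProjHom W p k a) (tateProjHom W p k b)) := by
  rw [weilPairingPadicCoord, muVal_muTransfer, Units.coe_map, MonoidHom.coe_coe, coe_muVal_weilPairingHom]

include hcompat in
/-- ★ **Coherence of the coordinates**: the `p`-th power map `μ_{p^{k+1}}(F̄) → μ_{p^k}(F̄)` (the transition map of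
`muPadicSystem F p`) sends the level-`(k+1)` coordinate to the level-`k` coordinate (tower compatibility of the `e_k` and
`p · pr_{k+1} = pr_k`). [cite: SilvermanAEC2009, Prop. III.8.1 (e)] [cite: NeukirchSchmidtWingberg2008, II §7 (2.7.5)] -/
theorem red_weilPairingPadicCoord_succ (k : ℕ) (a b : W.tateModule p) :
    (muPadicSystem F p).red (n := k) (m := k + 1) (Nat.le_succ k)
        (weilPairingPadicCoord W F p e hμ hadd₁ hadd₂ (k + 1) a b) =
      weilPairingPadicCoord W F p e hμ hadd₁ hadd₂ k a b := by
  rw [muPadicSystem_red]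
  apply muVal_injective F (p ^ k)
  apply Units.ext
  rw [muVal_muPow, Units.val_pow_eq_pow_val, coe_muVal_weilPairingPadicCoord, coe_muVal_weilPairingPadicCoord,
    Nat.add_sub_cancel_left, pow_one, ← map_pow, ← weil_tateProjHom_succ W p e hcompat k a b]

include hcompat in
/-- The family of coordinates lies in the inverse limit `ℤ_p(1)(F̄) = lim_k μ_{p^k}(F̄)` (successive coherence suffices along
the cofinal chain `k ↦ k`, `DiscreteInvSystem.chain_compat`). [cite: NeukirchSchmidtWingberg2008, II §7 (2.7.5)] -/
theorem weilPairingPadicCoord_mem_limit (a b : W.tateModule p) :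
    (fun k => weilPairingPadicCoord W F p e hμ hadd₁ hadd₂ k a b) ∈ (muPadicSystem F p).limit := fun _ _ h =>
  (muPadicSystem F p).chain_compat (muPadicChain F p) (fun h => (muPadicSystem F p).red h)
    (muPadicSystem F p).red_refl (fun h₁ h₂ x => (muPadicSystem F p).red_trans h₁ h₂ x)
    (fun k => weilPairingPadicCoord W F p e hμ hadd₁ hadd₂ k a b)
    (fun k => red_weilPairingPadicCoord_succ W F p e hμ hadd₁ hadd₂ hcompat k a b) h

/-- **`e_∞(a, b) ∈ ℤ_p(1)(F̄)`**, the value of the `ℤ_p(1)`-valued Weil pairing. [cite: NeukirchSchmidtWingberg2008, VII (7.2.6)] -/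
def weilPairingPadicVal (a b : W.tateModule p) : (muPadicSystem F p).limit :=
  ⟨fun k => weilPairingPadicCoord W F p e hμ hadd₁ hadd₂ k a b,
    weilPairingPadicCoord_mem_limit W F p e hμ hadd₁ hadd₂ hcompat a b⟩

/-- Coordinates of `e_∞(a, b)`. [cite: NeukirchSchmidtWingberg2008, VII (7.2.6)] -/
@[simp] theorem coe_weilPairingPadicVal (a b : W.tateModule p) (k : ℕ) :
    ((weilPairingPadicVal W F p e hμ hadd₁ hadd₂ hcompat a b : (muPadicSystem F p).limit) : ∀ k, MuCarrier F (p ^ k)) k =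
      weilPairingPadicCoord W F p e hμ hadd₁ hadd₂ k a b := rfl

/-- The coordinates are additive in the first variable. [cite: SilvermanAEC2009, Prop. III.8.1 (a)] -/
theorem weilPairingPadicCoord_add_left (k : ℕ) (a a' b : W.tateModule p) :
    weilPairingPadicCoord W F p e hμ hadd₁ hadd₂ k (a + a') b =
      weilPairingPadicCoord W F p e hμ hadd₁ hadd₂ k a b + weilPairingPadicCoord W F p e hμ hadd₁ hadd₂ k a' b := by
  simp only [weilPairingPadicCoord, map_add, AddMonoidHom.add_apply]

/-- The coordinates are additive in the second variable. [cite: SilvermanAEC2009, Prop. III.8.1 (a)] -/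
theorem weilPairingPadicCoord_add_right (k : ℕ) (a b b' : W.tateModule p) :
    weilPairingPadicCoord W F p e hμ hadd₁ hadd₂ k a (b + b') =
      weilPairingPadicCoord W F p e hμ hadd₁ hadd₂ k a b + weilPairingPadicCoord W F p e hμ hadd₁ hadd₂ k a b' := by
  simp only [weilPairingPadicCoord, map_add]

/-- **`e_∞ : T_pW →+ T_pW →+ ℤ_p(1)(F̄)`**, biadditive. [cite: NeukirchSchmidtWingberg2008, VII (7.2.6)] -/
def weilPairingPadicHom : W.tateModule p →+ W.tateModule p →+ (muPadicSystem F p).limit :=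
  AddMonoidHom.mk'
    (fun a => AddMonoidHom.mk' (fun b => weilPairingPadicVal W F p e hμ hadd₁ hadd₂ hcompat a b) fun b b' =>
      Subtype.ext (funext fun k => by
        simp only [coe_weilPairingPadicVal, AddSubgroup.coe_add, Pi.add_apply, weilPairingPadicCoord_add_right]))
    fun a a' => AddMonoidHom.ext fun b => Subtype.ext (funext fun k => by
      simp only [AddMonoidHom.mk'_apply, AddMonoidHom.add_apply, coe_weilPairingPadicVal, AddSubgroup.coe_add,
        Pi.add_apply, weilPairingPadicCoord_add_left])

/-- Coordinates of `e_∞`. [cite: NeukirchSchmidtWingberg2008, VII (7.2.6)] -/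
@[simp] theorem coe_weilPairingPadicHom (a b : W.tateModule p) (k : ℕ) :
    ((weilPairingPadicHom W F p e hμ hadd₁ hadd₂ hcompat a b : (muPadicSystem F p).limit) : ∀ k, MuCarrier F (p ^ k)) k =
      weilPairingPadicCoord W F p e hμ hadd₁ hadd₂ k a b := rfl

include hgal in
/-- The coordinates are `Γ_F`-equivariant (`Γ_F` acting on `T_pW` through `Γ_{K₀}`, on `μ_{p^k}(F̄)` naturally):
equivariance of `e_k` and of the transfer `ι_k` (`muTransfer_mu`). [cite: SilvermanAEC2009, Prop. III.8.1 (d)] -/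
theorem weilPairingPadicCoord_smul (k : ℕ) (σ : absoluteGaloisGroup F) (a b : W.tateModule p) :
    weilPairingPadicCoord W F p e hμ hadd₁ hadd₂ k (restrictedTateRep W F p σ a) (restrictedTateRep W F p σ b) =
      mu F (p ^ k) σ (weilPairingPadicCoord W F p e hμ hadd₁ hadd₂ k a b) := by
  rw [weilPairingPadicCoord, weilPairingPadicCoord, restrictedTateRep_apply_apply, restrictedTateRep_apply_apply,
    tateProjHom_smul, tateProjHom_smul, torsionGaloisModule_apply_apply, torsionGaloisModule_apply_apply,
    weilPairingHom_smul W p e hμ hadd₁ hadd₂ hgal, muTransfer_mu]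

include hgal in
/-- ★ **`e_∞` is `Γ_F`-equivariant**: `e_∞(σ a, σ b) = σ e_∞(a, b)` in `ℤ_p(1)(F̄)`. [cite: SilvermanAEC2009, Prop. III.8.1 (d)] -/
theorem weilPairingPadicHom_smul (σ : absoluteGaloisGroup F) (a b : W.tateModule p) :
    weilPairingPadicHom W F p e hμ hadd₁ hadd₂ hcompat (restrictedTateRep W F p σ a) (restrictedTateRep W F p σ b) =
      tateModuleMuPadic F p σ (weilPairingPadicHom W F p e hμ hadd₁ hadd₂ hcompat a b) :=
  Subtype.ext (funext fun k => by
    rw [coe_weilPairingPadicHom, weilPairingPadicCoord_smul W F p e hμ hadd₁ hadd₂ hgal]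
    rfl)

/-! ### The level-`p^k` Weil pairing with values transferred to `μ_{p^k}(F̄)` -/

include hgal in
/-- The level-`p^k` Weil pairing `E[p^k]|_{Γ_F} × E[p^k]|_{Γ_F} → μ_{p^k}(F̄)`, `(S, T) ↦ ι_k e_k(S, T)`, as a continuous
equivariant pairing of discrete `Γ_F`-modules. [cite: SilvermanAEC2009, Prop. III.8.1] [cite: MilneADT2006, I §6, proof of Prop. 6.9] -/
def weilContPairingTransfer (k : ℕ) :
    ContPairing (torsionRestricted W F (p ^ k)).toTopRep (torsionRestricted W F (p ^ k)).toTopRep (mu F (p ^ k)).toTopRep :=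
  pairing (torsionRestricted W F (p ^ k)) (torsionRestricted W F (p ^ k)) (mu F (p ^ k))
    ((weilPairingHom W (p ^ k) (e k) (hμ k) (hadd₁ k) (hadd₂ k)).compr₂ (muTransfer K₀ F (p ^ k)))
    fun σ S T => by
      rw [AddMonoidHom.compr₂_apply, AddMonoidHom.compr₂_apply, torsionRestricted_apply_apply,
        torsionRestricted_apply_apply, weilPairingHom_smul W p e hμ hadd₁ hadd₂ hgal, muTransfer_mu]

/-- Unfolding `weilContPairingTransfer`. [cite: SilvermanAEC2009, Prop. III.8.1] -/
@[simp] theorem weilContPairingTransfer_toLin_apply (k : ℕ) (S T : geomTorsion W ((p ^ k : ℕ) : ℤ)) :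
    (weilContPairingTransfer W F p e hμ hadd₁ hadd₂ hgal k).toLin S T =
      muTransfer K₀ F (p ^ k) (weilPairingHom W (p ^ k) (e k) (hμ k) (hadd₁ k) (hadd₂ k) S T) := rfl

include hgal in
/-- The coordinate maps `(a, b) ↦ ι_k e_k(pr_k a, pr_k b)` are continuous (they factor through the discrete `E[p^k] × E[p^k]`
along the continuous projections `pr_k`). [cite: SilvermanAEC2009, III §7] -/
theorem continuous_weilPairingPadicCoord (k : ℕ) :
    Continuous fun q : W.tateModule p × W.tateModule p => weilPairingPadicCoord W F p e hμ hadd₁ hadd₂ k q.1 q.2 := by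
  have hpr : Continuous (tateProjHom W p k) := (TateModule.continuous_proj k).subtype_mk _
  exact ((weilContPairingTransfer W F p e hμ hadd₁ hadd₂ hgal k).continuous_toLin.comp
    ((hpr.comp continuous_fst).prodMk (hpr.comp continuous_snd))).congr fun _ => rfl

/-! ### The pairing `e_∞` as a `ContPairing`, and the cup-product compatibilities -/

include hgal in
/-- `e_∞` is jointly continuous (coordinatewise continuity into the product of the discrete `μ_{p^k}(F̄)`).
[cite: NeukirchSchmidtWingberg2008, II §7 (2.7.5)] -/
theorem continuous_weilPairingPadicHom :
    Continuous fun q : W.tateModule p × W.tateModule p =>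
      weilPairingPadicHom W F p e hμ hadd₁ hadd₂ hcompat q.1 q.2 := by
  refine continuous_induced_rng.2 (continuous_pi fun k => ?_)
  exact continuous_weilPairingPadicCoord W F p e hμ hadd₁ hadd₂ hgal k

include hgal in
/-- ★ **The `ℤ_p(1)`-valued Weil pairing `e_∞ : T_pW|_{Γ_F} × T_pW|_{Γ_F} → ℤ_p(1)(F̄)` as a continuous equivariant pairing**
of the topological representations `PAdicHodge.restrictedTateRep W F p` and `GaloisCohomology.tateModuleMuPadic F p` — the cup-product
datum of Kato's pairing `H¹(K, T) × H¹(K, T*(1)) → H²(K, ℤ_p(1))` for `T = T_pE ≅ T*(1)`.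
[cite: Kato1993LNM1553, Ch. II §1.4, Thm. 1.4.1 (3)] [cite: NeukirchSchmidtWingberg2008, VII (7.2.6)] -/
def weilContPairingPadic :
    ContPairing (restrictedTateRep W F p).toTopRep (restrictedTateRep W F p).toTopRep (tateModuleMuPadic F p).toTopRep where
  toLin := LinearMap.mk₂ ℤ (fun a b => weilPairingPadicHom W F p e hμ hadd₁ hadd₂ hcompat a b)
    (fun a a' b => by rw [map_add, AddMonoidHom.add_apply])
    (fun c a b => by
      change (weilPairingPadicHom W F p e hμ hadd₁ hadd₂ hcompat).flip b (c • a) =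
        c • (weilPairingPadicHom W F p e hμ hadd₁ hadd₂ hcompat).flip b a
      rw [map_zsmul])
    (fun a b b' => map_add _ _ _) (fun c a b => map_zsmul _ _ _)
  continuous_toLin := continuous_weilPairingPadicHom W F p e hμ hadd₁ hadd₂ hgal hcompat
  toLin_smul σ a b := weilPairingPadicHom_smul W F p e hμ hadd₁ hadd₂ hgal hcompat σ a b

/-- Unfolding `weilContPairingPadic`. [cite: NeukirchSchmidtWingberg2008, VII (7.2.6)] -/
@[simp] theorem weilContPairingPadic_toLin_apply (a b : W.tateModule p) :
    (weilContPairingPadic W F p e hμ hadd₁ hadd₂ hgal hcompat).toLin a b =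
      weilPairingPadicHom W F p e hμ hadd₁ hadd₂ hcompat a b := rfl

/-- ★ **`H²(ℤ_p(1) ↠ μ_{p^k})(x ∪_∞ y) = (pr_k x) ∪_k (pr_k y)`**: the cup product of the `ℤ_p(1)`-valued Weil pairing projects,
at every level, to the cup product of the (transferred) level-`p^k` Weil pairing of the projected classes
(covariant naturality `ContPairing.cupProduct_map`; the coordinate of `e_∞` IS `ι_k e_k(pr_k ·, pr_k ·)`).
[cite: NeukirchSchmidtWingberg2008, I §4 (1.4.2)] [cite: Kato1993LNM1553, Ch. II §1.4] -/
theorem cohomologyMap_projHom_cupProduct_weilContPairingPadic (k : ℕ)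
    (x y : continuousCohomology 1 (restrictedTateRep W F p).toTopRep) :
    cohomologyMap ((muPadicSystem F p).projHom k) 2
        ((weilContPairingPadic W F p e hμ hadd₁ hadd₂ hgal hcompat).cupProduct x y) =
      (weilContPairingTransfer W F p e hμ hadd₁ hadd₂ hgal k).cupProduct
        (cohomologyMap (tateProjMor W F p k) 1 x) (cohomologyMap (tateProjMor W F p k) 1 y) :=
  ContPairing.cupProduct_map _ _ (tateProjMor W F p k) (tateProjMor W F p k) ((muPadicSystem F p).projHom k)
    (fun _ _ => rfl) x y

/-- The restricted level-`p^k` Weil cup product of `LocalWeilPairingDuality.lean`, carried to `H²(Γ_F, μ_{p^k}(F̄))` along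
`muRestrictIso`, is the cup product of the transferred pairing (naturality with `α = β = id`).
[cite: NeukirchSchmidtWingberg2008, I §4 (1.4.2)] -/
theorem cohomologyMap_muRestrictIso_cupProduct_restrict [CharZero F] [CharZero K₀] (k : ℕ)
    (x' y' : continuousCohomology 1 (torsionRestricted W F (p ^ k)).toTopRep) :
    cohomologyMap (muRestrictIso K₀ (p ^ k) F).hom 2
        (((weilContPairing W (p ^ k) (e k) (hμ k) (hadd₁ k) (hadd₂ k) (hgal k)).restrict
          (absGaloisRestrict K₀ F)).cupProduct x' y') =
      (weilContPairingTransfer W F p e hμ hadd₁ hadd₂ hgal k).cupProduct x' y' := by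
  refine (ContPairing.cupProduct_map
    ((weilContPairing W (p ^ k) (e k) (hμ k) (hadd₁ k) (hadd₂ k) (hgal k)).restrict (absGaloisRestrict K₀ F))
    (weilContPairingTransfer W F p e hμ hadd₁ hadd₂ hgal k) (𝟙 _) (𝟙 _) (muRestrictIso K₀ (p ^ k) F).hom
    (fun _ _ => rfl) x' y').trans ?_
  exact congrArg₂ (fun z w => (weilContPairingTransfer W F p e hμ hadd₁ hadd₂ hgal k).cupProduct z w)
    (map_apply_of_id _ (fun _ => rfl) _ (fun _ => rfl) 1 x') (map_apply_of_id _ (fun _ => rfl) _ (fun _ => rfl) 1 y')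

/-! ### The bridge: `⟨x, y⟩ = inv_∞(x ∪_{e_∞} y)` -/

variable [W.IsElliptic] [CharZero F] [ValuativeRel F] [TopologicalSpace F] [IsNonarchimedeanLocalField F] [CharZero K₀]

/-- ★★ **The tree's `ℤ_p`-valued local Tate pairing is `inv_∞` of the cup product for the `ℤ_p(1)`-valued Weil pairing**:
`⟨x, y⟩ = inv_∞(x ∪_{e_∞} y)` for all `x, y ∈ H¹(F, T_pW|_{Γ_F})` — Kato's `H¹(K, T) × H¹(K, T*(1)) →(∪) H²(K, ℤ_p(1)) ≅ ℤ_p`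
(II §1.4, Thm. 1.4.1 (1), (3)) coincides with the limit of the level-`p^k` self-pairings `⟨pr_k x, pr_k y⟩_{p^k, inv_{p^k}}`
(both have the same residues: `toZModPow_invPadic`, the projection formula above, `levelTatePairing_eq_iota_weilCupProduct`).
[cite: Kato1993LNM1553, Ch. II §1.4, Thm. 1.4.1 (1) and (3)] [cite: NeukirchSchmidtWingberg2008, VII (7.2.6)] -/
theorem tatePairing_eq_invPadic_cupProduct (x y : continuousCohomology 1 (restrictedTateRep W F p).toTopRep) :
    tatePairing W F p e hμ hadd₁ hadd₂ hgal hcompat x y =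
      invPadic F p ((weilContPairingPadic W F p e hμ hadd₁ hadd₂ hgal hcompat).cupProduct x y) := by
  refine (eq_tatePairing_of_toZModPow W F p e hμ hadd₁ hadd₂ hgal hcompat x y _ fun k => ?_).symm
  rw [toZModPow_invPadic]
  change Prop121vii.invLevel F (p ^ k) (cohomologyMap ((muPadicSystem F p).projHom k) 2
      ((weilContPairingPadic W F p e hμ hadd₁ hadd₂ hgal hcompat).cupProduct x y)) =
    tateLevelValue W F p e hμ hadd₁ hadd₂ hgal k x y
  rw [tateLevelValue, levelTatePairing_eq_iota_weilCupProduct, cohomologyMap_muRestrictIso_cupProduct_restrict,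
    cohomologyMap_projHom_cupProduct_weilContPairingPadic]
  rfl

/-- On cocycle representatives: `⟨[η], [η']⟩ = inv_∞[(σ, τ) ↦ e_∞(η σ, σ η' τ)]` (the cup product of crossed homomorphisms is
the class of the inhomogeneous `2`-cocycle `ContPairing.cupCocycle`). [cite: Kato1993LNM1553, Ch. II §1.4] -/
theorem tatePairing_oneCocycleClass_eq_invPadic_twoCocycleClass
    (η η' : contOneCocycles (restrictedTateRep W F p).toTopRep) :
    tatePairing W F p e hμ hadd₁ hadd₂ hgal hcompat (oneCocycleClass _ η) (oneCocycleClass _ η') =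
      invPadic F p (twoCocycleClass _
        ((weilContPairingPadic W F p e hμ hadd₁ hadd₂ hgal hcompat).cupCocycle η η')) := by
  rw [tatePairing_eq_invPadic_cupProduct, ContPairing.cupProduct_oneCocycleClass_eq_twoCocycleClass]

/-- **The pairing with the Kummer image as `inv_∞` of a cup product**: if `y ∈ H¹(F, T_pW|_{Γ_F})` is a `T`-adic Kummer class of
`P ∈ E(F)` (all its projections are the level Kummer classes `κ_{p^k}(P)`), then `⟨x, P⟩ = inv_∞(x ∪_{e_∞} y)` — the left-hand
side of the reciprocity law [REC] (`tatePairingPoint`) in Kato's `H²(K, ℤ_p(1))`-currency.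
[cite: Kato1993LNM1553, Ch. II §1.4, Thm. 1.4.1 (3)] [cite: BlochKato1990, Prop. 3.8 (p. 354)] -/
theorem tatePairingPoint_eq_invPadic_cupProduct (x y : continuousCohomology 1 (restrictedTateRep W F p).toTopRep)
    (P : (W.baseChange F).toAffine.Point)
    (hy : ∀ k, (cohomologyMap (tateProjMor W F p k) 1).hom y = kummerLevelClass W F p k P) :
    tatePairingPoint W F p e hμ hadd₁ hadd₂ hgal hcompat x P =
      invPadic F p ((weilContPairingPadic W F p e hμ hadd₁ hadd₂ hgal hcompat).cupProduct x y) := by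
  rw [← tatePairing_eq_tatePairingPoint W F p e hμ hadd₁ hadd₂ hgal hcompat x y P hy, tatePairing_eq_invPadic_cupProduct]

end Literature.NumberTheory.EllipticCurves

end
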